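import Mathlib
import HarnessLib
import Summits.NavierStokesRegularity.NavierStokesRegularity.Theorems.TaylorModelRungThreeReadoutVTubeWin
import Summits.NavierStokesRegularity.NavierStokesRegularity.Theorems.TaylorModelRungThreeReadoutVCrossing

/-!
# Line `taylor-model` on crux K1b-DR (stmt-NavierStokesRegularity-23954) — G2-v-W: the CROSSING of the section under the
# WINDOWED v3 certificate `ReadoutsVW`, its LOCATION INSIDE THE EMITTED WINDOWS, and K1b-DR's (E1) read-outs (ns-tm-g4 g6)

Port of `…ReadoutVCrossing` to `ReadoutsVW cd bx rd ro rw` (`…VReadoutsWinDefs`) plus the one new argument of the windowed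
read-outs.  Setting as there: `ChainVCore`, `IsFlowPackageV`, a polytope trajectory `φ j q` with the G1-v node invariant.

* `exists_inStep_repr` — every state of the last sub-step reached from a hull-`l` start `y ∈ H^l_{S−1}` at `u ∈ [0,h]` IS of the
  in-step form `TP(u) + r + kapp A (y − x)` with `InStepKer … u A` and `|r| ≤ J·u^(p+1)` on the window ((F8″) + (F5′); the
  shape (R6)/(W2)–(W4) quantify over);
* `stAt_mem_YW`, `sigma_smoothVW`, `crossing_factsVW` — verbatim ports ((R6), (R0), (R5)+(R7): strict monotonicity of the section
  value over the whole last sub-step, the crossing time `tauSel`, its state in the FAT box `Y¹`);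
* **`crossing_windowW`** (NEW) — for a trajectory whose node `S−1` state lies in the level-`l` hull, the crossing time satisfies
  `Tn (S−1) + ulo l ≤ τ ≤ Tn (S−1) + uhi l` and the crossing state lies in the WINDOWED box `Z^l = [zlo l, zhi l]`: by (W2)/(W3) the
  section value is `< lev` at `Tn (S−1) + ulo l` and `> lev` at `Tn (S−1) + uhi l`, and by `crossing_factsVW` it is `< lev` exactly
  before `τ` and `> lev` exactly after; then (W4) at `u = τ − Tn (S−1)`;
* `readE1_ofVW`, `kBlockE1_crossing_ofVW` — K1b-DR's (E1) block with (R8w) read on `Z¹` (level-1 window).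

MODEL-lattice rung TL-M3 only; nothing here is a statement about the Navier–Stokes equations.
-/

noncomputable section

-- the sub-problem namespace repeats the summit name by design (D-0017)
set_option linter.dupNamespace false

namespace Summit.NavierStokesRegularity.NavierStokesRegularity.Theorems.TaylorModelV

open Set Finset
open Literature.Analysis.FluidPDE.TaoCascade Literature.Analysis.FluidPDE.TaoCascade.TaylorChain
open Summit.NavierStokesRegularity.NavierStokesRegularity.Theorems.TaylorModelMajorant
open Summit.NavierStokesRegularity.NavierStokesRegularity.Theorems.TaylorModelVector
open Summit.NavierStokesRegularity.NavierStokesRegularity.Theorems.TaylorModelReadout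

variable {cd : CertData} {bx : StepBoxes} {rd : RadiiData} {ro : ReadoutData} {rw : WinData} {φ : Flow}

/-! ### The in-step representation of a last-sub-step state -/

/-- **In-step representation ((F8″) + (F5′)).** A state reached at `u ∈ [0,h]` of sub-step `s` from a hull-`l` start `y`
(`l : Fin 3`) is `TP(u) + r + kapp A (y − x)` for an in-step kernel `A` at `u` and a remainder `r` with `|r| ≤ J·u^(p+1)` on the
window (as functions, on all coordinates). [folklore] -/
theorem exists_inStep_repr (hSN : cd.StageNumerics) (hC : ChainVCore cd bx) (hF : IsFlowPackageV cd bx φ)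
    {j : ℕ} (hj : j ≤ cd.N₀) {s : ℕ} (hs : s < cd.S j) (l : Fin 3) {y : Fin 4 → ℤ → ℝ}
    (hy : InBox cd (bx.hlo l j s) (bx.hhi l j s) y) {u : ℝ} (hu : u ∈ Icc 0 (cd.h j s)) :
    ∃ (A : Ker) (r : Fin 4 → ℤ → ℝ), InStepKer cd bx j s u A ∧
      AbsLeW cd r (fun i k => bx.J j s i k * u ^ (cd.pdeg + 1)) ∧
      stAt φ j y u = cd.TP j s u + r + kapp cd A (y - cd.x j s) := by
  -- the start and the centre are outer-hull starts
  have hy2 : InBox cd (bx.hlo 2 j s) (bx.hhi 2 j s) y := by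
    obtain ⟨-, -, -, -, -, -, -, -, -, -, -, -, -, hnest⟩ := (hC j hj).2.2.1 _ hs.le
    intro i k hk1 hk2
    exact ⟨(hnest _ i k).1.trans (hy i k hk1 hk2).1, (hy i k hk1 hk2).2.trans (hnest _ i k).2⟩
  have hx2 := x_mem_hull hC hj hs.le (2 : Fin 3)
  obtain ⟨A, hA, hAeq⟩ := exists_inStepKer_diff hSN hC hF hj hs hy2 hx2 hu
  obtain ⟨-, -, -, hF5, -⟩ := ((hF.2 j hj).2.2 _ hs)
  refine ⟨A, stAt φ j y u - cd.TP j s u - kapp cd A (y - cd.x j s), hA, ?_, ?_⟩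
  · intro i k hk1 hk2
    have h1 := hF5 _ hx2 u hu i k hk1 hk2
    rw [TP_eq_taylorSum hC hj hs.le]
    have h2 := hAeq i k hk1 hk2
    simp only [Pi.sub_apply] at h1 h2 ⊢
    have e : stAt φ j y u i k - (∑ n ∈ Finset.range (cd.pdeg + 1), taylorJet cd.Qb (cd.x j s) n i k * u ^ n) -
        kapp cd A (y - cd.x j s) i k =
        stAt φ j (cd.x j s) u i k - ∑ n ∈ Finset.range (cd.pdeg + 1), taylorJet cd.Qb (cd.x j s) n i k * u ^ n := by
      linarith
    rw [e]
    exact h1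
  · funext i k
    simp only [Pi.add_apply, Pi.sub_apply]
    ring

/-! ### Ports of `…ReadoutVCrossing` -/

/-- **In-step boxes of the last sub-step ((R6))** under `ReadoutsVW`. [folklore] -/
theorem stAt_mem_YW (hSN : cd.StageNumerics) (hC : ChainVCore cd bx) (hF : IsFlowPackageV cd bx φ) (hRO : ReadoutsVW cd bx rd ro rw)
    {j : ℕ} (hj : j ≤ cd.N₀) (l : Fin 2) {y : Fin 4 → ℤ → ℝ}
    (hy : InBox cd (bx.hlo (hullLevel l) j (cd.S j - 1)) (bx.hhi (hullLevel l) j (cd.S j - 1)) y)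
    {u : ℝ} (hu : u ∈ Icc 0 (cd.h j (cd.S j - 1))) :
    InBox cd (ro.ylo l j) (ro.yhi l j) (stAt φ j y u) := by
  have hS : 1 ≤ cd.S j := (hC j hj).1
  have hs : cd.S j - 1 < cd.S j := Nat.sub_lt hS Nat.one_pos
  obtain ⟨-, -, -, -, -, -, -, -, -, -, -, -, hR6, -⟩ := hRO j hj
  obtain ⟨A, r, hA, hr, heq⟩ := exists_inStep_repr hSN hC hF hj hs (hullLevel l) hy hu
  rw [heq]
  exact hR6 l u hu A hA y hy r hr

/-- **The section value along a polytope trajectory is C¹** under `ReadoutsVW` ((R0e)). [folklore] -/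
theorem sigma_smoothVW (hRO : ReadoutsVW cd bx rd ro rw) {j : ℕ} (hj : j ≤ cd.N₀) {q : Fin 4 → ℤ → ℝ}
    (hq : SolvesOn cd φ j q (cd.Tn j (cd.S j))) :
    ContinuousOn (fun s => cd.σf j (stAt φ j q s)) (Icc 0 (cd.Tn j (cd.S j))) ∧
      ∀ t ∈ Icc 0 (cd.Tn j (cd.S j)), HasDerivWithinAt (fun s => cd.σf j (stAt φ j q s))
        (cd.σf j (cd.Qb (stAt φ j q t) (stAt φ j q t))) (Icc 0 (cd.Tn j (cd.S j))) t := by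
  obtain ⟨-, -, -, -, hσw, -⟩ := hRO j hj
  let L : (Fin (nW cd) → ℝ) →L[ℝ] ℝ :=
    LinearMap.toContinuousLinearMap ((cd.σf j).comp (IsLinearMap.mk' (ofVec cd) ⟨ofVec_add cd, ofVec_smul cd⟩))
  have hL : ∀ y : Fin 4 → ℤ → ℝ, cd.σf j y = L (toVec cd y) := by
    intro y
    show cd.σf j y = cd.σf j (ofVec cd (toVec cd y))
    rw [ofVec_toVec]
    exact hσw y
  have hder : ∀ t ∈ Icc 0 (cd.Tn j (cd.S j)), HasDerivWithinAt (fun s => cd.σf j (stAt φ j q s))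
      (cd.σf j (cd.Qb (stAt φ j q t) (stAt φ j q t))) (Icc 0 (cd.Tn j (cd.S j))) t := by
    intro t ht
    have hX : HasDerivWithinAt (fun s => toVec cd (stAt φ j q s)) (toVec cd (cd.qT (stAt φ j q t)))
        (Icc 0 (cd.Tn j (cd.S j))) t := by
      refine hasDerivWithinAt_pi.2 fun c => ?_
      have hk := shellOf_mem cd c
      have h1 := (hq (modeOf cd c) (shellOf cd c) hk.1 hk.2).2 t ht
      rw [quadTerm_trunc_eq_qT (cd := cd) _ _ hk] at h1
      exact h1
    have h2 := L.hasFDerivAt.comp_hasDerivWithinAt t hX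
    have hfun : (fun s => cd.σf j (stAt φ j q s)) = ⇑L ∘ fun s => toVec cd (stAt φ j q s) := by
      funext s; exact hL _
    have hval : L (toVec cd (cd.qT (stAt φ j q t))) = cd.σf j (cd.Qb (stAt φ j q t) (stAt φ j q t)) := by
      rw [Qb_self, ← hL]
    rw [hfun, ← hval]
    exact h2
  exact ⟨fun t ht => (hder t ht).continuousWithinAt, hder⟩

/-- **The crossing in the last sub-step** under `ReadoutsVW`. With `τ := tauSel cd φ j q`: `Tn (S−1) < τ ≤ Tn S`,
`σf (φ(q)(τ)) = lev`, `σf < lev` on `[Tn (S−1), τ)`, `lev < σf` on `(τ, Tn S]`, and the crossing state lies in the FAT box `Y¹`.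
[folklore] -/
theorem crossing_factsVW (hSN : cd.StageNumerics) (hC : ChainVCore cd bx) (hF : IsFlowPackageV cd bx φ) (hRO : ReadoutsVW cd bx rd ro rw)
    {j : ℕ} (hj : j ≤ cd.N₀) {q : Fin 4 → ℤ → ℝ} (hq : SolvesOn cd φ j q (cd.Tn j (cd.S j)))
    (hqN : ∀ s, s ≤ cd.S j → InBox cd (bx.hlo 1 j s) (bx.hhi 1 j s) (stAt φ j q (cd.Tn j s))) :
    cd.Tn j (cd.S j - 1) < tauSel cd φ j q ∧ tauSel cd φ j q ≤ cd.Tn j (cd.S j) ∧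
      cd.σf j (stAt φ j q (tauSel cd φ j q)) = cd.lev j ∧
      (∀ t, cd.Tn j (cd.S j - 1) ≤ t → t < tauSel cd φ j q → cd.σf j (stAt φ j q t) < cd.lev j) ∧
      (∀ t, tauSel cd φ j q < t → t ≤ cd.Tn j (cd.S j) → cd.lev j < cd.σf j (stAt φ j q t)) ∧
      InBox cd (ro.ylo 1 j) (ro.yhi 1 j) (stAt φ j q (tauSel cd φ j q)) := by
  have hS : 1 ≤ cd.S j := (hC j hj).1
  have hs : cd.S j - 1 < cd.S j := Nat.sub_lt hS Nat.one_pos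
  obtain ⟨-, -, hγ, -, -, -, -, -, -, -, hR5a, hR5b, -, hR7, -⟩ := hRO j hj
  have hTs := ((gridV hC hj).2.1 _ hs).2
  rw [Nat.sub_add_cancel hS] at hTs
  have h0 : 0 ≤ cd.Tn j (cd.S j - 1) := (gridV hC hj).2.2.2 _ hs.le
  have hab : cd.Tn j (cd.S j - 1) ≤ cd.Tn j (cd.S j) := by rw [hTs]; linarith [((gridV hC hj).2.1 _ hs).1]
  -- the trajectory during the last sub-step lies in `Y¹`
  have hshift := (polyNode_shift hC hF hj hq hs.le).2
  have hY : ∀ t, cd.Tn j (cd.S j - 1) ≤ t → t ≤ cd.Tn j (cd.S j) →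
      InBox cd (ro.ylo 1 j) (ro.yhi 1 j) (stAt φ j q t) := by
    intro t h1 h2
    rw [hshift t ⟨h1, h2⟩]
    exact stAt_mem_YW hSN hC hF hRO hj 1 (hqN _ hs.le) ⟨by linarith, by rw [hTs] at h2; linarith⟩
  -- strict monotonicity of the section value on the last sub-step
  obtain ⟨hcont, hder⟩ := sigma_smoothVW hRO hj hq
  have hmono : StrictMonoOn (fun s => cd.σf j (stAt φ j q s)) (Icc (cd.Tn j (cd.S j - 1)) (cd.Tn j (cd.S j))) := by
    refine strictMonoOn_of_deriv_pos (convex_Icc _ _) (hcont.mono (Icc_subset_Icc_left h0)) ?_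
    intro x hx
    rw [interior_Icc] at hx
    have hd := hder x ⟨h0.trans hx.1.le, hx.2.le⟩
    rw [(hd.hasDerivAt (Icc_mem_nhds (h0.trans_lt hx.1) hx.2)).deriv]
    exact hγ.trans_le (hR7 _ (hY x hx.1.le hx.2.le))
  -- signs at the two nodes
  have hlt : cd.σf j (stAt φ j q (cd.Tn j (cd.S j - 1))) < cd.lev j := hR5a _ (hqN _ hs.le)
  have hgt : cd.lev j < cd.σf j (stAt φ j q (cd.Tn j (cd.S j))) := hR5b _ (hqN _ le_rfl)
  obtain ⟨τ, hL, h1, h2, h3, h4, h5⟩ :=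
    G2.exists_isLeast_crossing hab (hcont.mono (Icc_subset_Icc_left h0)) hmono hlt hgt
  have hτ : tauSel cd φ j q = τ := hL.csInf_eq.symm ▸ rfl
  · rw [hτ]
    exact ⟨h1, h2, h3, h4, h5, hY τ h1.le h2⟩

/-! ### NEW: the crossing lies in the emitted window of its level -/

/-- **The crossing inside the level-`l` window.** For a trajectory with the G1-v node invariant whose node `S−1` state lies
in the level-`l` hull (`l = 1`: every polytope trajectory; `l = 0`: the base trajectory), the crossing time satisfies
`Tn (S−1) + ulo l ≤ τ ≤ Tn (S−1) + uhi l` and the crossing state lies in the WINDOWED box `[zlo l, zhi l]` ((W1)–(W4) with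
`crossing_factsVW`). [folklore] -/
theorem crossing_windowW (hSN : cd.StageNumerics) (hC : ChainVCore cd bx) (hF : IsFlowPackageV cd bx φ) (hRO : ReadoutsVW cd bx rd ro rw)
    {j : ℕ} (hj : j ≤ cd.N₀) {q : Fin 4 → ℤ → ℝ} (hq : SolvesOn cd φ j q (cd.Tn j (cd.S j)))
    (hqN : ∀ s, s ≤ cd.S j → InBox cd (bx.hlo 1 j s) (bx.hhi 1 j s) (stAt φ j q (cd.Tn j s))) (l : Fin 2)
    (hl : InBox cd (bx.hlo (hullLevel l) j (cd.S j - 1)) (bx.hhi (hullLevel l) j (cd.S j - 1)) (stAt φ j q (cd.Tn j (cd.S j - 1)))) :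
    cd.Tn j (cd.S j - 1) + rw.ulo l j ≤ tauSel cd φ j q ∧ tauSel cd φ j q ≤ cd.Tn j (cd.S j - 1) + rw.uhi l j ∧
      InBox cd (rw.zlo l j) (rw.zhi l j) (stAt φ j q (tauSel cd φ j q)) := by
  have hS : 1 ≤ cd.S j := (hC j hj).1
  have hs : cd.S j - 1 < cd.S j := Nat.sub_lt hS Nat.one_pos
  obtain ⟨-, -, -, -, -, -, -, -, -, -, -, -, -, -, -, -, -, -, hW1, hW2, hW3, hW4⟩ := hRO j hj
  obtain ⟨h1, h2, h3, h4, h5, -⟩ := crossing_factsVW hSN hC hF hRO hj hq hqN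
  have hTs := ((gridV hC hj).2.1 _ hs).2
  rw [Nat.sub_add_cancel hS] at hTs
  -- window bounds of level `l` inside `[0, h]`
  have hlo0 : 0 ≤ rw.ulo l j ∧ rw.uhi l j ≤ cd.h j (cd.S j - 1) ∧ rw.ulo l j ≤ rw.uhi l j := by
    obtain ⟨a1, a2, a3, a4, a5⟩ := hW1
    rcases l with ⟨_ | _ | l2, hl2⟩
    · exact ⟨a1.trans a2, a4.trans a5, a3⟩
    · exact ⟨a1, a5, a2.trans (a3.trans a4)⟩
    · omega
  obtain ⟨hu0, huh, hlohi⟩ := hlo0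
  have hshift := (polyNode_shift hC hF hj hq hs.le).2
  set y := stAt φ j q (cd.Tn j (cd.S j - 1)) with hy
  -- the state at `Tn (S−1) + u` in in-step form, for `u ∈ [0,h]`
  have hform : ∀ u, u ∈ Icc 0 (cd.h j (cd.S j - 1)) →
      ∃ (A : Ker) (r : Fin 4 → ℤ → ℝ), InStepKer cd bx j (cd.S j - 1) u A ∧
        AbsLeW cd r (fun i k => bx.J j (cd.S j - 1) i k * u ^ (cd.pdeg + 1)) ∧
        stAt φ j q (cd.Tn j (cd.S j - 1) + u) = cd.TP j (cd.S j - 1) u + r + kapp cd A (y - cd.x j (cd.S j - 1)) := by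
    intro u hu
    obtain ⟨A, r, hA, hr, heq⟩ := exists_inStep_repr hSN hC hF hj hs (hullLevel l) hl hu
    refine ⟨A, r, hA, hr, ?_⟩
    rw [hshift (cd.Tn j (cd.S j - 1) + u) ⟨by linarith [hu.1], by rw [hTs]; linarith [hu.2]⟩, ← heq]
    congr 1
    ring
  -- before the window start the section value is `< lev`, so `τ` is not there
  have hlo : cd.Tn j (cd.S j - 1) + rw.ulo l j ≤ tauSel cd φ j q := by
    obtain ⟨A, r, hA, hr, heq⟩ := hform (rw.ulo l j) ⟨hu0, hlohi.trans huh⟩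
    have hlt : cd.σf j (stAt φ j q (cd.Tn j (cd.S j - 1) + rw.ulo l j)) < cd.lev j := by
      rw [heq]; exact hW2 l A hA y hl r hr
    by_contra hne
    rw [not_le] at hne
    have hle : cd.Tn j (cd.S j - 1) + rw.ulo l j ≤ cd.Tn j (cd.S j) := by rw [hTs]; linarith [hlohi.trans huh]
    have := h5 _ hne hle
    linarith
  -- after the window end the section value is `> lev`, so `τ` is not there either
  have hhi : tauSel cd φ j q ≤ cd.Tn j (cd.S j - 1) + rw.uhi l j := by
    obtain ⟨A, r, hA, hr, heq⟩ := hform (rw.uhi l j) ⟨hu0.trans hlohi, huh⟩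
    have hgt : cd.lev j < cd.σf j (stAt φ j q (cd.Tn j (cd.S j - 1) + rw.uhi l j)) := by
      rw [heq]; exact hW3 l A hA y hl r hr
    by_contra hne
    rw [not_le] at hne
    have hge : cd.Tn j (cd.S j - 1) ≤ cd.Tn j (cd.S j - 1) + rw.uhi l j := by linarith [hu0.trans hlohi]
    have := h4 _ hge hne
    linarith
  refine ⟨hlo, hhi, ?_⟩
  -- the crossing state in in-step form at `u* := τ − Tn (S−1) ∈ [ulo l, uhi l]`
  have hu : tauSel cd φ j q - cd.Tn j (cd.S j - 1) ∈ Icc 0 (cd.h j (cd.S j - 1)) :=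
    ⟨by linarith, by rw [hTs] at h2; linarith⟩
  obtain ⟨A, r, hA, hr, heq⟩ := hform _ hu
  have e : cd.Tn j (cd.S j - 1) + (tauSel cd φ j q - cd.Tn j (cd.S j - 1)) = tauSel cd φ j q := by ring
  rw [e] at heq
  rw [heq]
  exact hW4 l _ ⟨by linarith, by linarith⟩ A hA y hl r hr

/-! ### K1b-DR's (E1) block -/

/-- **K1b-DR's (E1) block at stage `j` for the polytope point `q`** under `ReadoutsVW` ((R8w) read on the level-1 window box
`Z¹`), with the crossing-time bounds `0 ≤ τ ≤ Tn S`. [folklore] -/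
theorem readE1_ofVW (hSN : cd.StageNumerics) (hC : ChainVCore cd bx) (hF : IsFlowPackageV cd bx φ) (hRO : ReadoutsVW cd bx rd ro rw)
    {j : ℕ} (hj : j ≤ cd.N₀) {q : Fin 4 → ℤ → ℝ} (hq : SolvesOn cd φ j q (cd.Tn j (cd.S j)))
    (hqN : ∀ s, s ≤ cd.S j → InBox cd (bx.hlo 1 j s) (bx.hhi 1 j s) (stAt φ j q (cd.Tn j s))) :
    (0 ≤ tauSel cd φ j q ∧ tauSel cd φ j q ≤ cd.Tn j (cd.S j)) ∧
    0 < tauSel cd φ j q ∧ tauSel cd φ j q ≤ cd.τs ∧ cd.as j ≤ |φ j q cd.i₀ 1 (tauSel cd φ j q)| ∧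
      (∀ i k, -cd.Kb ≤ k → k ≤ cd.Ka → φ j q i k 0 = q i k ∧ ∀ t ∈ Icc 0 (tauSel cd φ j q),
        |φ j q i k t| ≤ cd.M k - cd.Λ j * cd.δ j * cd.τs * cd.ω j k - cd.mm) ∧
      (∀ i, |φ j q i (-cd.Kb) (tauSel cd φ j q)| + cd.Λ j * cd.δ j * cd.τs * cd.ω j (-cd.Kb) ≤
        (2:ℝ) ^ (-cd.θ) * (cd.Cb * (2:ℝ) ^ ((3:ℝ) / 4 * ((cd.Kb:ℝ) + 1)))) := by
  have hS : 1 ≤ cd.S j := (hC j hj).1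
  have hs : cd.S j - 1 < cd.S j := Nat.sub_lt hS Nat.one_pos
  obtain ⟨hτs, -, -, -, -, -, -, -, -, hR4, -, -, -, -, hR8, -⟩ := hRO j hj
  obtain ⟨h1, h2, h3, -, -, -⟩ := crossing_factsVW hSN hC hF hRO hj hq hqN
  obtain ⟨-, -, hZ⟩ := crossing_windowW hSN hC hF hRO hj hq hqN 1 (by simpa [hullLevel] using hqN _ hs.le)
  have h0 : 0 ≤ cd.Tn j (cd.S j - 1) := (gridV hC hj).2.2.2 _ (Nat.sub_le _ _)
  have hpos : 0 < tauSel cd φ j q := h0.trans_lt h1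
  obtain ⟨has, hbs⟩ := hR8 _ hZ h3
  refine ⟨⟨hpos.le, h2⟩, hpos, h2.trans hτs, has, fun i k hk1 hk2 => ⟨(hq i k hk1 hk2).1, fun t ht => ?_⟩,
    fun i => hbs i⟩
  -- window bounds along `[0, τ] ⊆ [0, Tn S]`: locate the sub-step of `t` and use (F1′) + (R4)
  have hS0 : 0 < cd.S j := hS
  have hT0 : cd.Tn j 0 ≤ t := by rw [(gridV hC hj).1]; exact ht.1
  obtain ⟨s, -, hs', hts, hts1⟩ := G3.exists_substep (cd := cd) (j := j) hS0 hT0 (ht.2.trans h2)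
  obtain ⟨-, hB⟩ := polyNode_solves_inBox hC hF hj hq hs' (hqN s hs'.le)
  have hTs := ((gridV hC hj).2.1 _ hs').2
  have hu : t - cd.Tn j s ∈ Icc 0 (cd.h j s) := ⟨by linarith, by rw [hTs] at hts1; linarith⟩
  have hst : stAt φ j q t = stAt φ j (stAt φ j q (cd.Tn j s)) (t - cd.Tn j s) :=
    (polyNode_shift hC hF hj hq hs'.le).2 t ⟨hts, ht.2.trans h2⟩
  have hb := hB _ hu i k hk1 hk2
  rw [← hst] at hb
  have h4 := hR4 s hs' i k hk1 hk2
  have e : φ j q i k t = stAt φ j q t i k := rfl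
  rw [e, abs_le]
  constructor <;> linarith [hb.1, hb.2, h4.2.2.1, h4.2.2.2]

/-- **`KBlockE1 cd φ (tauSel cd φ)` and `0 ≤ τ ≤ Tn S` from the WINDOWED v3 certificate**, given the G1-v node invariant of every
polytope trajectory. [folklore] -/
theorem kBlockE1_crossing_ofVW (hSN : cd.StageNumerics) (hC : ChainVCore cd bx) (hF : IsFlowPackageV cd bx φ)
    (hRO : ReadoutsVW cd bx rd ro rw)
    (hPN : ∀ j, j ≤ cd.N₀ → ∀ q, InPoly cd j q →
      SolvesOn cd φ j q (cd.Tn j (cd.S j)) ∧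
        ∀ s, s ≤ cd.S j → InBox cd (bx.hlo 1 j s) (bx.hhi 1 j s) (stAt φ j q (cd.Tn j s))) :
    KBlockE1 cd φ (tauSel cd φ) ∧
      ∀ j, j ≤ cd.N₀ → ∀ q, InPoly cd j q → 0 ≤ tauSel cd φ j q ∧ tauSel cd φ j q ≤ cd.Tn j (cd.S j) := by
  constructor
  · intro j hj q hq
    obtain ⟨hqS, hqN⟩ := hPN j hj q hq
    exact (readE1_ofVW hSN hC hF hRO hj hqS hqN).2
  · intro j hj q hq
    obtain ⟨hqS, hqN⟩ := hPN j hj q hq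
    exact (readE1_ofVW hSN hC hF hRO hj hqS hqN).1

end Summit.NavierStokesRegularity.NavierStokesRegularity.Theorems.TaylorModelV

end
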